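import Summits.Ventures.HodgeRepro2.T5IwasawaSplit

/-!
# T5IwasawaClaim — the CLAIM `|a(i(g,1))|⁻² = det((1 + g g*)/2)` of N4.3 (P1) with its Iwasawa
# factorisation EXISTING, and the kernel-certified erratum to `T5ParabolicBlocks`
# (blind cell pub-hodge-repro2; support for route/T5-N4-p5.md, N4.3 = (R3))

With the doubled form `formHJ J = fromBlocks 0 J J 0` of `T5IwasawaSplit` (`J` a hermitian
involution, the Gram matrix of `W`): the embedded `i(g, 1) = T5ParabolicBlocks.doubling g`
preserves `formHJ J` EXACTLY when `g ∈ U(J)` (`doubling_preserves_formHJ_iff`; the block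
computation is `doubling_form`), hence has an Iwasawa factorisation `doubling g = p · k`
(`T5IwasawaSplit.exists_factorisation`), and the Levi part of ANY such factorisation satisfies
`|det A_p|⁻² = det(½(1 + g gᴴ))` (`normSq_det_levi`, from `Dᴴ J A = J` and the bottom-row
identity of `T5ParabolicBlocks`).  `normSq_det_levi_exists` packages both; `claim_U11` is the
rank-one case `J = T5UnitaryBound.J = diag(1, −1)`, `g ∈ U(1,1)`, with the value
`T5UnitaryBound.Delta g`.

**Erratum (kernel-certified).** `T5ParabolicBlocks.normSq_det_levi` (seat p1, gen 8) states the
CLAIM modulo `hp` (the parabolic factor preserves `formH = fromBlocks 0 1 1 0`, i.e. `J = 1`),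
`hk` (`k kᴴ = 1`) and `hx` (`doubling g = p k`).  For `J = 1` these hypotheses are jointly
satisfiable ONLY when `g` is unitary: `doubling_preserves_formH_iff` (`doubling g ∈ U(formH)` iff
`gᴴ g = 1`) and `unitary_of_factorisation_formH` (`doubling g = p k`, `p ∈ U(formH)`, `k` unitary
⟹ `g gᴴ = 1`, via `M H M = H` for `M = p pᴴ = doubling g (doubling g)ᴴ` and the spectral
theorem, `eq_one_of_posSemidef_of_sq_eq_one`).  So for the non-compact `g ∈ U(1,1)` the
factorisation assumed in the `[K*]` row of T5-SUPPORT-p1 v5 §S4 («THE CLAIM») does not exist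
with that form, and the row was vacuous for the objects it was meant for; the corrected kernel
row is `normSq_det_levi_exists` / `claim_U11`.  The printed CLAIM of N4.3 (P1) is unaffected
(its form is `formHJ J`, as the prose says: the pairing of `Y_n` with `Y_n^∇` is `J`).

Mathlib + own prefix; no sorry; axioms ⊆ {propext, Classical.choice, Quot.sound}.
-/

namespace Summit.Ventures.HodgeRepro2.T5IwasawaClaim

open Matrix
open scoped ComplexOrder
open T5IwasawaSplit

variable {n : Type*} [Fintype n] [DecidableEq n]

/-! ## `i(g, 1) = doubling g` lies in `U(formHJ J)` exactly when `g ∈ U(J)` -/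

omit [Fintype n] [DecidableEq n] in
/-- `(1/4) P + (1/4) Q = (1/2) Y` when `P + Q = Y + Y`. -/
theorem quarter_sum (P Q Y : Matrix n n ℂ) (h : P + Q = Y + Y) :
    (1 / 4 : ℂ) • P + (1 / 4 : ℂ) • Q = (1 / 2 : ℂ) • Y := by
  rw [← smul_add, h, ← two_smul ℂ, smul_smul]
  norm_num

/-- The form `formHJ J` transported by `doubling g`, in blocks:
`fromBlocks (½(gᴴJg − J)) (½(gᴴJg + J)) (½(gᴴJg + J)) (½(gᴴJg − J))`. -/
theorem doubling_form (J g : Matrix n n ℂ) :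
    (T5ParabolicBlocks.doubling g)ᴴ * formHJ J * T5ParabolicBlocks.doubling g =
      fromBlocks ((1 / 2 : ℂ) • (gᴴ * J * g - J)) ((1 / 2 : ℂ) • (gᴴ * J * g + J))
        ((1 / 2 : ℂ) • (gᴴ * J * g + J)) ((1 / 2 : ℂ) • (gᴴ * J * g - J)) := by
  have hstar : star (1 / 2 : ℂ) = 1 / 2 := by simp
  have key : ∀ (P Q : Matrix n n ℂ),
      ((1 / 2 : ℂ) • P)ᴴ * J * ((1 / 2 : ℂ) • Q) = (1 / 4 : ℂ) • (Pᴴ * J * Q) := by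
    intro P Q
    rw [conjTranspose_smul, hstar, Matrix.smul_mul, Matrix.smul_mul, Matrix.mul_smul, smul_smul]
    norm_num
  simp only [T5ParabolicBlocks.doubling, formHJ, fromBlocks_conjTranspose, fromBlocks_multiply,
    Matrix.mul_zero, zero_add, add_zero, key]
  rw [fromBlocks_inj]
  refine ⟨?_, ?_, ?_, ?_⟩ <;> apply quarter_sum <;>
    simp only [conjTranspose_add, conjTranspose_sub, conjTranspose_one, Matrix.add_mul,
      Matrix.mul_add, Matrix.sub_mul, Matrix.mul_sub, Matrix.one_mul, Matrix.mul_one] <;> abel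

/-- `doubling g ∈ U(formHJ J)` for every `g ∈ U(J)`: the embedded `i(g, 1)` preserves the doubled
form (this is the fact that makes the hypotheses of the CLAIM satisfiable). -/
theorem doubling_preserves_formHJ {J g : Matrix n n ℂ} (hg : gᴴ * J * g = J) :
    (T5ParabolicBlocks.doubling g)ᴴ * formHJ J * T5ParabolicBlocks.doubling g = formHJ J := by
  rw [doubling_form, hg, sub_self, smul_zero, ← two_smul ℂ, smul_smul, formHJ]
  norm_num

/-- Conversely `doubling g ∈ U(formHJ J)` forces `g ∈ U(J)`. -/
theorem doubling_preserves_formHJ_iff (J g : Matrix n n ℂ) :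
    (T5ParabolicBlocks.doubling g)ᴴ * formHJ J * T5ParabolicBlocks.doubling g = formHJ J ↔
      gᴴ * J * g = J := by
  refine ⟨fun h => ?_, doubling_preserves_formHJ⟩
  rw [doubling_form, formHJ, fromBlocks_inj] at h
  obtain ⟨h11, -, -, -⟩ := h
  have h2 : (2 : ℂ) • ((1 / 2 : ℂ) • (gᴴ * J * g - J)) = 0 := by rw [h11, smul_zero]
  rw [smul_smul] at h2
  norm_num at h2
  exact sub_eq_zero.1 h2

/-- **Erratum, kernel form.** For the form `formH = fromBlocks 0 1 1 0` of `T5ParabolicBlocks`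
(`J = 1`), `doubling g` preserves the form iff `g` is UNITARY — so for the non-compact
`g ∈ U(1,1)` the hypotheses `hp`/`hk`/`hx` of `T5ParabolicBlocks.normSq_det_levi` are not the
Iwasawa hypotheses of `i(g,1)` (see `unitary_of_factorisation_formH` below). -/
theorem doubling_preserves_formH_iff (g : Matrix n n ℂ) :
    (T5ParabolicBlocks.doubling g)ᴴ * T5ParabolicBlocks.formH * T5ParabolicBlocks.doubling g =
      T5ParabolicBlocks.formH ↔ gᴴ * g = 1 := by
  rw [← formHJ_one, doubling_preserves_formHJ_iff, Matrix.mul_one]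

/-! ## The CLAIM of N4.3 (P1), `|a(i(g,1))|⁻² = det((1 + g g*)/2)`, for the correct form -/

/-- The CLAIM for the form `formHJ J`: if `doubling g = p · k` with `k` unitary and
`p = fromBlocks A B 0 D ∈ U(formHJ J)`, then `|det A|⁻² = det(½(1 + g gᴴ))`
(the analogue of `T5ParabolicBlocks.normSq_det_levi`; `Dᴴ J A = J` replaces `Dᴴ A = 1`). -/
theorem normSq_det_levi {J g A B D : Matrix n n ℂ} {k : Matrix (n ⊕ n) (n ⊕ n) ℂ}
    (hJ2 : J * J = 1) (hk : k * kᴴ = 1)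
    (hp : (fromBlocks A B 0 D)ᴴ * formHJ J * fromBlocks A B 0 D = formHJ J)
    (hx : T5ParabolicBlocks.doubling g = fromBlocks A B 0 D * k) :
    ((Complex.normSq A.det : ℂ))⁻¹ = ((1 / 2 : ℂ) • (1 + g * gᴴ)).det := by
  obtain ⟨-, hDA, -⟩ := parabolic_relations hp
  have hdetJ : J.det ≠ 0 := by
    intro h
    have := congrArg det hJ2
    rw [det_mul, h, zero_mul, det_one] at this
    exact zero_ne_one this
  have hdet : star D.det * A.det = 1 := by
    have h := congrArg det hDA
    rw [det_mul, det_mul, det_conjTranspose] at h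
    have h' : (star D.det * A.det) * J.det = 1 * J.det := by linear_combination h
    exact mul_right_cancel₀ hdetJ h'
  have hnorm : Complex.normSq D.det * Complex.normSq A.det = 1 := by
    have h := congrArg Complex.normSq hdet
    rwa [Complex.normSq_mul, Complex.star_def, Complex.normSq_conj, Complex.normSq_one] at h
  have hinv : (Complex.normSq A.det)⁻¹ = Complex.normSq D.det :=
    (eq_inv_of_mul_eq_one_left hnorm).symm
  rw [← Complex.ofReal_inv, hinv, ← T5ParabolicBlocks.det_mul_conjTranspose,
    ← T5ParabolicBlocks.bottom_row_identity A B D k hk, ← hx,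
    T5ParabolicBlocks.doubling_bottom_identity]

/-- **The CLAIM, unconditionally.** For `J` a hermitian involution and `g ∈ U(J)`, the embedded
`i(g, 1) = doubling g` HAS an Iwasawa factorisation `p · k` for the doubled form `formHJ J`, and
its Levi part satisfies `|det A_p|⁻² = det(½(1 + g gᴴ))` — the `[K*]` row of T5-SUPPORT-p1 §S4
with its hypotheses discharged. -/
theorem normSq_det_levi_exists {J g : Matrix n n ℂ} (hJ : Jᴴ = J) (hJ2 : J * J = 1)
    (hg : gᴴ * J * g = J) :
    ∃ (A B D : Matrix n n ℂ) (k : Matrix (n ⊕ n) (n ⊕ n) ℂ),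
      k * kᴴ = 1 ∧ kᴴ * formHJ J * k = formHJ J ∧
      (fromBlocks A B 0 D)ᴴ * formHJ J * fromBlocks A B 0 D = formHJ J ∧
      T5ParabolicBlocks.doubling g = fromBlocks A B 0 D * k ∧
      ((Complex.normSq A.det : ℂ))⁻¹ = ((1 / 2 : ℂ) • (1 + g * gᴴ)).det := by
  obtain ⟨A, B, D, k, hk, hkH, hp, hx⟩ :=
    exists_factorisation hJ hJ2 (doubling_preserves_formHJ hg)
  exact ⟨A, B, D, k, hk, hkH, hp, hx, normSq_det_levi hJ2 hk hp hx⟩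

/-! ## The rank-one case `U(1,1)`: `J = diag(1, −1) = T5UnitaryBound.J` -/

/-- `T5UnitaryBound.J` is hermitian. -/
theorem J_conjTranspose : (T5UnitaryBound.J)ᴴ = T5UnitaryBound.J := by
  ext i j
  fin_cases i <;> fin_cases j <;> simp [T5UnitaryBound.J]

/-- `T5UnitaryBound.J` is an involution. -/
theorem J_mul_J : T5UnitaryBound.J * T5UnitaryBound.J = 1 := by
  rw [T5UnitaryBound.J, Matrix.mul_fin_two, Matrix.one_fin_two]
  norm_num

/-- The CLAIM for `U(1,1)`: for every `g ∈ U(1,1)` (`T5UnitaryBound.MemU11 g`) the embedded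
`i(g, 1)` factors as `p · k` for the doubled form `formHJ J`, with
`|det A_p|⁻² = T5UnitaryBound.Delta g = det(½(1 + g gᴴ))` — the rank-one CLAIM of N4.3 (P1)
with the factorisation EXISTING, not assumed. -/
theorem claim_U11 {g : Matrix (Fin 2) (Fin 2) ℂ} (hg : T5UnitaryBound.MemU11 g) :
    ∃ (A B D : Matrix (Fin 2) (Fin 2) ℂ) (k : Matrix (Fin 2 ⊕ Fin 2) (Fin 2 ⊕ Fin 2) ℂ),
      k * kᴴ = 1 ∧ kᴴ * formHJ T5UnitaryBound.J * k = formHJ T5UnitaryBound.J ∧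
      (fromBlocks A B 0 D)ᴴ * formHJ T5UnitaryBound.J * fromBlocks A B 0 D =
        formHJ T5UnitaryBound.J ∧
      T5ParabolicBlocks.doubling g = fromBlocks A B 0 D * k ∧
      ((Complex.normSq A.det : ℂ))⁻¹ = T5UnitaryBound.Delta g :=
  normSq_det_levi_exists J_conjTranspose J_mul_J hg

/-! ## Erratum, kernel form: with `formH` (`J = 1`) the hypotheses of
`T5ParabolicBlocks.normSq_det_levi` force `g` to be unitary -/

/-- A positive semidefinite matrix whose square is `1` is `1` (spectral theorem). -/
theorem eq_one_of_posSemidef_of_sq_eq_one {X : Matrix n n ℂ} (hX : X.PosSemidef)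
    (h2 : X * X = 1) : X = 1 := by
  have hH : X.IsHermitian := hX.1
  have hlam : ∀ i, 0 ≤ hH.eigenvalues i := hX.eigenvalues_nonneg
  set U : Matrix n n ℂ := (hH.eigenvectorUnitary : Matrix n n ℂ) with hU
  have hUU : Uᴴ * U = 1 := by
    have := Matrix.UnitaryGroup.star_mul_self hH.eigenvectorUnitary
    simpa only [star_eq_conjTranspose] using this
  have hUU' : U * Uᴴ = 1 := mul_eq_one_comm.1 hUU
  set Dg : Matrix n n ℂ := diagonal (RCLike.ofReal ∘ hH.eigenvalues) with hDg
  have hspec : X = U * Dg * Uᴴ := by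
    have := hH.spectral_theorem
    rw [Unitary.conjStarAlgAut_apply] at this
    simpa only [star_eq_conjTranspose] using this
  have hDD : Dg * Dg = 1 := by
    have h1 : U * (Dg * Dg) * Uᴴ = 1 := by
      calc U * (Dg * Dg) * Uᴴ = (U * Dg * Uᴴ) * (U * Dg * Uᴴ) := by
            simp only [Matrix.mul_assoc]
            rw [← Matrix.mul_assoc Uᴴ U, hUU, Matrix.one_mul]
        _ = 1 := by rw [← hspec, h2]
    calc Dg * Dg = Uᴴ * (U * (Dg * Dg) * Uᴴ) * U := by
          simp only [Matrix.mul_assoc]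
          rw [← Matrix.mul_assoc Uᴴ U, hUU, Matrix.one_mul, Matrix.mul_one]
      _ = 1 := by rw [h1, Matrix.mul_one, hUU]
  have hD1 : Dg = 1 := by
    rw [hDg, diagonal_mul_diagonal, ← diagonal_one, diagonal_eq_diagonal_iff] at hDD
    rw [hDg, ← diagonal_one, diagonal_eq_diagonal_iff]
    intro i
    have hi := hDD i
    simp only [Function.comp_apply] at hi ⊢
    have hcast : (RCLike.ofReal (hH.eigenvalues i) : ℂ) = ((hH.eigenvalues i : ℝ) : ℂ) := rfl
    rw [hcast] at hi ⊢
    have hr : hH.eigenvalues i * hH.eigenvalues i = 1 := by exact_mod_cast hi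
    rcases mul_self_eq_one_iff.1 hr with h | h
    · rw [h]; simp
    · linarith [hlam i]
  rw [hspec, hD1, Matrix.mul_one, hUU']

/-- `doubling g · (doubling g)ᴴ = fromBlocks S T T S` with `S = ½(1 + g gᴴ)`, `T = ½(g gᴴ − 1)`. -/
theorem doubling_mul_conjTranspose (g : Matrix n n ℂ) :
    T5ParabolicBlocks.doubling g * (T5ParabolicBlocks.doubling g)ᴴ =
      fromBlocks ((1 / 2 : ℂ) • (1 + g * gᴴ)) ((1 / 2 : ℂ) • (g * gᴴ - 1))
        ((1 / 2 : ℂ) • (g * gᴴ - 1)) ((1 / 2 : ℂ) • (1 + g * gᴴ)) := by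
  have hstar : star (1 / 2 : ℂ) = 1 / 2 := by simp
  have key : ∀ (P Q : Matrix n n ℂ),
      ((1 / 2 : ℂ) • P) * ((1 / 2 : ℂ) • Q)ᴴ = (1 / 4 : ℂ) • (P * Qᴴ) := by
    intro P Q
    rw [conjTranspose_smul, hstar, Matrix.smul_mul, Matrix.mul_smul, smul_smul]
    norm_num
  simp only [T5ParabolicBlocks.doubling, fromBlocks_conjTranspose, fromBlocks_multiply, key]
  rw [fromBlocks_inj]
  refine ⟨?_, ?_, ?_, ?_⟩ <;> apply quarter_sum <;>
    simp only [conjTranspose_add, conjTranspose_sub, conjTranspose_one, Matrix.add_mul,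
      Matrix.mul_add, Matrix.sub_mul, Matrix.mul_sub, Matrix.one_mul, Matrix.mul_one] <;> abel

/-- If `doubling g = p · k` with `k` unitary and `p ∈ U(formH)` (`J = 1`), then `(g gᴴ)² = 1`
(from `M H M = H` for `M = p pᴴ = doubling g (doubling g)ᴴ`). -/
theorem sq_eq_one_of_factorisation_formH {g : Matrix n n ℂ} {p k : Matrix (n ⊕ n) (n ⊕ n) ℂ}
    (hk : k * kᴴ = 1) (hp : pᴴ * T5ParabolicBlocks.formH * p = T5ParabolicBlocks.formH)
    (hx : T5ParabolicBlocks.doubling g = p * k) : (g * gᴴ) * (g * gᴴ) = 1 := by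
  have hH2 : T5ParabolicBlocks.formH * T5ParabolicBlocks.formH = (1 : Matrix (n ⊕ n) (n ⊕ n) ℂ) := by
    rw [← formHJ_one]; exact formHJ_mul_self (Matrix.mul_one 1)
  have hpinv : p * (T5ParabolicBlocks.formH * pᴴ * T5ParabolicBlocks.formH) = 1 :=
    mul_eq_one_comm.1 (inv_mul_of_preserves _ p hH2 hp)
  have hpHp : p * T5ParabolicBlocks.formH * pᴴ = T5ParabolicBlocks.formH := by
    calc p * T5ParabolicBlocks.formH * pᴴ
        = (p * (T5ParabolicBlocks.formH * pᴴ * T5ParabolicBlocks.formH)) *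
            T5ParabolicBlocks.formH := by
          simp only [Matrix.mul_assoc, hH2, Matrix.mul_one]
      _ = T5ParabolicBlocks.formH := by rw [hpinv, Matrix.one_mul]
  have hM : T5ParabolicBlocks.doubling g * (T5ParabolicBlocks.doubling g)ᴴ *
      T5ParabolicBlocks.formH * (T5ParabolicBlocks.doubling g * (T5ParabolicBlocks.doubling g)ᴴ) =
      T5ParabolicBlocks.formH := by
    rw [hx, conjTranspose_mul]
    calc p * k * (kᴴ * pᴴ) * T5ParabolicBlocks.formH * (p * k * (kᴴ * pᴴ))
        = p * (k * kᴴ) * (pᴴ * T5ParabolicBlocks.formH * p) * (k * kᴴ) * pᴴ := by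
          simp only [Matrix.mul_assoc]
      _ = T5ParabolicBlocks.formH := by rw [hk, Matrix.mul_one, hp, Matrix.mul_one, hpHp]
  rw [doubling_mul_conjTranspose, T5ParabolicBlocks.formH] at hM
  simp only [fromBlocks_multiply, Matrix.mul_zero, Matrix.mul_one, zero_add, add_zero] at hM
  rw [fromBlocks_inj] at hM
  obtain ⟨-, h12, -, -⟩ := hM
  have key : ∀ (P Q : Matrix n n ℂ),
      ((1 / 2 : ℂ) • P) * ((1 / 2 : ℂ) • Q) = (1 / 4 : ℂ) • (P * Q) := by
    intro P Q
    rw [Matrix.smul_mul, Matrix.mul_smul, smul_smul]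
    norm_num
  rw [key, key, quarter_sum _ _ (g * gᴴ * (g * gᴴ) + 1)] at h12
  · have h2 : (2 : ℂ) • ((1 / 2 : ℂ) • (g * gᴴ * (g * gᴴ) + 1)) = (2 : ℂ) • (1 : Matrix n n ℂ) := by
      rw [h12]
    rw [smul_smul, two_smul] at h2
    norm_num at h2
    rw [← one_add_one_eq_two] at h2
    exact add_right_cancel h2
  · simp only [Matrix.add_mul, Matrix.mul_add, Matrix.sub_mul, Matrix.mul_sub, Matrix.one_mul,
      Matrix.mul_one]
    abel

/-- **Erratum, kernel form.** The hypotheses `hk`, `hp`, `hx` of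
`T5ParabolicBlocks.normSq_det_levi` (form `formH`, `J = 1`) are satisfiable only for UNITARY `g`:
for `g ∈ U(1,1)` with `g gᴴ ≠ 1` no factorisation `doubling g = p · k` with `p ∈ U(formH)`,
`k` unitary exists, so that theorem is vacuous for the non-compact `g` it was meant for; the
corrected statement is `normSq_det_levi_exists` / `claim_U11` above (form `formHJ J`). -/
theorem unitary_of_factorisation_formH {g : Matrix n n ℂ} {p k : Matrix (n ⊕ n) (n ⊕ n) ℂ}
    (hk : k * kᴴ = 1) (hp : pᴴ * T5ParabolicBlocks.formH * p = T5ParabolicBlocks.formH)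
    (hx : T5ParabolicBlocks.doubling g = p * k) : g * gᴴ = 1 :=
  eq_one_of_posSemidef_of_sq_eq_one (posSemidef_self_mul_conjTranspose g)
    (sq_eq_one_of_factorisation_formH hk hp hx)


/-! ## Appendix (v2, appended): `P(Y_n) ∩ K` for `formHJ J` and the well-definedness of
`|a(x)| := |det A_p|` — the J-versions of `T5ParabolicBlocks.parabolic_unitary` and
`norm_det_levi_well_defined` (which, like `normSq_det_levi`, are about the form `formH`, `J = 1`) -/

/-- `P(Y_n) ∩ K` for `formHJ J`: a unitary Siegel-parabolic element of `U(formHJ J)` is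
`fromBlocks A 0 0 (J A J)` with `A` unitary. -/
theorem parabolic_unitary {J A B D : Matrix n n ℂ} (hJ2 : J * J = 1)
    (hp : (fromBlocks A B 0 D)ᴴ * formHJ J * fromBlocks A B 0 D = formHJ J)
    (hpu : fromBlocks A B 0 D * (fromBlocks A B 0 D)ᴴ = 1) :
    B = 0 ∧ A * Aᴴ = 1 ∧ D = J * A * J := by
  have hcomm : formHJ J * fromBlocks A B 0 D = fromBlocks A B 0 D * formHJ J := by
    calc formHJ J * fromBlocks A B 0 D
        = (fromBlocks A B 0 D * (fromBlocks A B 0 D)ᴴ) * formHJ J * fromBlocks A B 0 D := by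
          rw [hpu, Matrix.one_mul]
      _ = fromBlocks A B 0 D * ((fromBlocks A B 0 D)ᴴ * formHJ J * fromBlocks A B 0 D) := by
          simp only [Matrix.mul_assoc]
      _ = fromBlocks A B 0 D * formHJ J := by rw [hp]
  rw [formHJ] at hcomm
  simp only [fromBlocks_multiply, Matrix.mul_zero, Matrix.zero_mul, zero_add, add_zero] at hcomm
  rw [fromBlocks_inj] at hcomm
  obtain ⟨h11, h12, -, -⟩ := hcomm
  have hB : B = 0 := by
    have h := congrArg (fun M => M * J) h11
    simpa [Matrix.mul_assoc, hJ2] using h.symm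
  have hD : D = J * A * J := by
    have h := congrArg (fun M => J * M) h12
    simpa [← Matrix.mul_assoc, hJ2] using h
  refine ⟨hB, ?_, hD⟩
  rw [hB, fromBlocks_conjTranspose, fromBlocks_multiply, conjTranspose_zero] at hpu
  simp only [Matrix.mul_zero, add_zero, Matrix.zero_mul] at hpu
  rw [← fromBlocks_one, fromBlocks_inj] at hpu
  exact hpu.1

/-- `|det J| = 1` for an involution `J`. -/
theorem norm_det_involution {J : Matrix n n ℂ} (hJ2 : J * J = 1) : ‖J.det‖ = 1 := by
  have h : J.det * J.det = 1 := by rw [← det_mul, hJ2, det_one]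
  have h' : ‖J.det‖ * ‖J.det‖ = 1 := by rw [← norm_mul, h, norm_one]
  nlinarith [norm_nonneg J.det]

/-- **`|a(x)|` is well defined** for `formHJ J`: if `p k = p′ k′` with `p, p′` Siegel-parabolic in
`U(formHJ J)` and `k, k′` unitary, then `|det A_p| = |det A_{p′}|`. -/
theorem norm_det_levi_well_defined {J A B D A' B' D' : Matrix n n ℂ}
    {k k' : Matrix (n ⊕ n) (n ⊕ n) ℂ} (hJ2 : J * J = 1)
    (hp : (fromBlocks A B 0 D)ᴴ * formHJ J * fromBlocks A B 0 D = formHJ J)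
    (hp' : (fromBlocks A' B' 0 D')ᴴ * formHJ J * fromBlocks A' B' 0 D' = formHJ J)
    (hk : k * kᴴ = 1) (hk' : k' * k'ᴴ = 1)
    (h : fromBlocks A B 0 D * k = fromBlocks A' B' 0 D' * k') : ‖A.det‖ = ‖A'.det‖ := by
  have hH2 := formHJ_mul_self (n := n) hJ2
  -- the inverse `r` of `p′`
  set r := formHJ J * (fromBlocks A' B' 0 D')ᴴ * formHJ J with hr
  have hrp' : r * fromBlocks A' B' 0 D' = 1 := inv_mul_of_preserves _ _ hH2 hp'
  have hrH : rᴴ * formHJ J * r = formHJ J := inv_preserves _ _ hH2 hp'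
  -- `q = r p = k′ kᴴ` is parabolic, in `U(formHJ J)` and unitary
  have hkk : kᴴ * k = 1 := mul_eq_one_comm.1 hk
  have hq : r * fromBlocks A B 0 D = k' * kᴴ := by
    have h2 : fromBlocks A B 0 D = fromBlocks A' B' 0 D' * k' * kᴴ := by
      calc fromBlocks A B 0 D = fromBlocks A B 0 D * k * kᴴ := by
            rw [Matrix.mul_assoc, hk, Matrix.mul_one]
        _ = fromBlocks A' B' 0 D' * k' * kᴴ := by rw [h]
    rw [h2, ← Matrix.mul_assoc, ← Matrix.mul_assoc, hrp', Matrix.one_mul]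
  have hqu : (r * fromBlocks A B 0 D) * (r * fromBlocks A B 0 D)ᴴ = 1 := by
    rw [hq, conjTranspose_mul, conjTranspose_conjTranspose]
    calc k' * kᴴ * (k * k'ᴴ) = k' * (kᴴ * k) * k'ᴴ := by simp only [Matrix.mul_assoc]
      _ = 1 := by rw [hkk, Matrix.mul_one, hk']
  have hqH : (r * fromBlocks A B 0 D)ᴴ * formHJ J * (r * fromBlocks A B 0 D) = formHJ J :=
    preserves_mul _ _ _ hrH hp
  -- the blocks of `q`
  rw [hr, formHJ_conjTranspose_parabolic_formHJ, fromBlocks_multiply] at hqu hqH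
  simp only [Matrix.mul_zero, Matrix.zero_mul, add_zero, zero_add] at hqu hqH
  obtain ⟨-, hAq, -⟩ := parabolic_unitary hJ2 hqH hqu
  -- `|det (J D′ᴴ J A)| = 1` and `|det D′| |det A′| = 1`
  have h1 : ‖(J * D'ᴴ * J * A).det‖ = 1 := by
    have hdet := congrArg det hAq
    rw [det_mul, det_conjTranspose, det_one] at hdet
    have : ‖(J * D'ᴴ * J * A).det‖ * ‖(J * D'ᴴ * J * A).det‖ = 1 := by
      have h' := congrArg norm hdet
      rwa [norm_mul, norm_star, norm_one] at h'
    nlinarith [norm_nonneg (J * D'ᴴ * J * A).det]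
  obtain ⟨-, hDA', -⟩ := parabolic_relations hp'
  have h2 : ‖D'.det‖ * ‖A'.det‖ = 1 := by
    have hdet := congrArg det hDA'
    rw [det_mul, det_mul, det_conjTranspose] at hdet
    have hJ0 : ‖J.det‖ ≠ 0 := by rw [norm_det_involution hJ2]; exact one_ne_zero
    have := congrArg norm hdet
    rw [norm_mul, norm_mul, norm_star] at this
    exact mul_right_cancel₀ hJ0 (by linear_combination this)
  rw [det_mul, det_mul, det_mul, norm_mul, norm_mul, norm_mul, det_conjTranspose, norm_star,
    norm_det_involution hJ2, one_mul, mul_one] at h1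
  -- `‖D'.det‖ * ‖A.det‖ = 1` and `‖D'.det‖ * ‖A'.det‖ = 1`
  have hD0 : ‖D'.det‖ ≠ 0 := by
    intro h0; rw [h0, zero_mul] at h2; exact zero_ne_one h2
  exact mul_left_cancel₀ hD0 (h1.trans h2.symm)

end Summit.Ventures.HodgeRepro2.T5IwasawaClaim
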